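import Literature.NumberTheory.Transcendental.GammaMonomialsProofs
import Literature.NumberTheory.Transcendental.LindemannWeierstrassProofs

/-!
# FermatIsogeny deep targets — LEVEL FIVE: the first open transcendence shadow, typed EXACTLY
(decomp-kz · lens-5 · g22, companion file B; STANDALONE: tree-only imports, does not import the node file `DeepWordSector.lean`)

The node file proves `betaWordSectorLevel_iff_of_rohrlichHodgeAt : 0 < N → RohrlichHodgeAt N → ∀ k, (Box k N ↔ Chain_SameType k N)`
with `RohrlichHodgeAt N := ∀ n, IsAlgebraic ℚ (∏ m ∈ Ico 1 N, Γ(m/N)^{n m}) → IsHodgeTypeGammaMonomial N n 0`, proves `RohrlichHodgeAt 2`,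
and derives `RohrlichHodgeAt 3, 4, 6` from Chudnovsky's theorem.  Level `5` (φ(5) = 4) is the first level where the shadow is OPEN.
This file types it exactly: with

* `GammaFifthPiIndep := ∀ a b c : ℤ, (a ≠ 0 ∨ b ≠ 0 ∨ c ≠ 0) → Transcendental ℚ (Γ(⅕)^a · Γ(⅖)^b · π^c)`
  (multiplicative independence of `Γ(⅕), Γ(⅖), π` modulo `ℚ̄ˣ` — OPEN; implied by the conjectured algebraic independence of
  `π, Γ(⅕), Γ(⅖)` (cite Waldschmidt2006, §3 after Theorem 16 (Grinspan: at least two of `π, Γ(⅕), Γ(⅖)` are algebraically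
  independent)); a HYPOTHESIS / conjecture, never a fact),

we PROVE `rohrlichHodgeAtFive_iff : RohrlichHodgeAtFive ↔ GammaFifthPiIndep`, where `RohrlichHodgeAtFive` is `RohrlichHodgeAt 5` written
out verbatim (same casts), so that inside the node module `RohrlichHodgeAt 5 ↔ GammaFifthPiIndep` is this theorem by `Iff.rfl`-transport.
Ingredients: reflection `Γ(⅕)Γ(⅘) = π / sin(π/5)`, `Γ(⅖)Γ(⅗) = π / sin(2π/5)`, `cos(π/5) = (1+√5)/4` (Mathlib), the generator table
`Γ(m/5) = c_m Γ(⅕)^{a_m} Γ(⅖)^{b_m} π^{e_m}` with `a = (1,0,0,−1)`, `b = (0,1,−1,0)`, `e = (0,0,1,1)`, and the lattice fact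
«DKO type ≡ 0 at level 5 ⟺ n ∈ ℤ·(1,−1,−1,1) ⟺ (A,B,C) = 0».  Sorry-free, no new axiom.
-/

noncomputable section

open Literature.NumberTheory.Transcendental

namespace Summit.KontsevichZagierPeriods.FermatIsogeny.DeepTargets.LevelFive

/-- `RohrlichHodgeAt 5` of the node file, verbatim (kept syntactically identical: `((m:ℝ) / ((5:ℕ):ℝ))`). [this node] -/
def RohrlichHodgeAtFive : Prop :=
  ∀ n : ℕ → ℤ, IsAlgebraic ℚ (∏ m ∈ Finset.Ico (1:ℕ) 5, Real.Gamma ((m : ℝ) / ((5:ℕ):ℝ)) ^ n m) →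
    IsHodgeTypeGammaMonomial 5 n 0

/-- NAMED HYPOTHESIS (OPEN): `Γ(⅕), Γ(⅖), π` are multiplicatively independent modulo `ℚ̄ˣ` — no non-trivial monomial is algebraic.
Implied by the conjectural algebraic independence of `π, Γ(⅕), Γ(⅖)`; Grinspan proved only «two of the three».
(cite Waldschmidt2006, §3); a hypothesis, never a fact. -/
def GammaFifthPiIndep : Prop :=
  ∀ a b c : ℤ, (a ≠ 0 ∨ b ≠ 0 ∨ c ≠ 0) →
    Transcendental ℚ (Real.Gamma ((1:ℝ)/5) ^ a * Real.Gamma ((2:ℝ)/5) ^ b * Real.pi ^ c)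

/-! ### helpers -/

/-- Auxiliary step `isAlgebraic_zpow`: is Algebraic zpow. [bookkeeping] -/
private theorem isAlgebraic_zpow {x : ℝ} (hx : IsAlgebraic ℚ x) (m : ℤ) : IsAlgebraic ℚ (x ^ m) := by
  cases m with
  | ofNat k => rw [Int.ofNat_eq_natCast, zpow_natCast]; exact hx.pow k
  | negSucc k => rw [zpow_negSucc]; exact (hx.pow _).inv

/-- Auxiliary step `isAlgebraic_sqrt_nat`: is Algebraic sqrt nat. [bookkeeping] -/
private theorem isAlgebraic_sqrt_nat (n : ℕ) : IsAlgebraic ℚ (Real.sqrt n) := by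
  refine ⟨Polynomial.X ^ 2 - Polynomial.C (n:ℚ), Polynomial.X_pow_sub_C_ne_zero (by norm_num) _, ?_⟩
  simp [Real.sq_sqrt (Nat.cast_nonneg n)]

/-- Auxiliary step `prod_Ico_one_five`: prod Ico one five. [bookkeeping] -/
theorem prod_Ico_one_five (f : ℕ → ℝ) : ∏ m ∈ Finset.Ico 1 5, f m = f 1 * f 2 * f 3 * f 4 := by
  rw [Finset.prod_Ico_eq_prod_range]; simp [Finset.prod_range_succ, mul_assoc]

/-- Auxiliary step `sum_Ico_one_five`: sum Ico one five. [bookkeeping] -/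
theorem sum_Ico_one_five (f : ℕ → ℚ) : ∑ m ∈ Finset.Ico 1 5, f m = f 1 + f 2 + f 3 + f 4 := by
  rw [Finset.sum_Ico_eq_sum_range]; simp [Finset.sum_range_succ, add_assoc]

/-- Auxiliary step `sum_Ico_one_five_int`: sum Ico one five int. [bookkeeping] -/
theorem sum_Ico_one_five_int (f : ℕ → ℤ) : ∑ m ∈ Finset.Ico 1 5, f m = f 1 + f 2 + f 3 + f 4 := by
  rw [Finset.sum_Ico_eq_sum_range]; simp [Finset.sum_range_succ, add_assoc]

/-- `Π_i (c_i·x^{a_i}·y^{b_i}·z^{e_i})^{n_i} = (Π_i c_i^{n_i})·x^{Σ a n}·y^{Σ b n}·z^{Σ e n}` (`x, y, z ≠ 0`). [folklore] -/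
theorem prod_mul_zpow3 {ι : Type*} (s : Finset ι) (c : ι → ℝ) (a b e n : ι → ℤ) {x y z : ℝ}
    (hx : x ≠ 0) (hy : y ≠ 0) (hz : z ≠ 0) :
    ∏ i ∈ s, (c i * x ^ a i * y ^ b i * z ^ e i) ^ n i
      = (∏ i ∈ s, c i ^ n i) * x ^ (∑ i ∈ s, a i * n i) * y ^ (∑ i ∈ s, b i * n i) * z ^ (∑ i ∈ s, e i * n i) := by
  classical
  refine Finset.induction_on s (by simp) ?_
  intro j s hj ih
  rw [Finset.prod_insert hj, Finset.prod_insert hj, Finset.sum_insert hj, Finset.sum_insert hj, Finset.sum_insert hj, ih,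
    zpow_add₀ hx, zpow_add₀ hy, zpow_add₀ hz, mul_zpow, mul_zpow, mul_zpow, ← zpow_mul, ← zpow_mul, ← zpow_mul]
  ring

/-- `cos(π/5)` is algebraic. [folklore; Mathlib `Real.cos_pi_div_five`] -/
theorem isAlgebraic_cos_pi_div_five : IsAlgebraic ℚ (Real.cos (Real.pi / 5)) := by
  rw [Real.cos_pi_div_five]
  have h1 : IsAlgebraic ℚ (1:ℝ) := isAlgebraic_one
  have h4 : IsAlgebraic ℚ (4:ℝ) := by simpa using isAlgebraic_nat (R := ℚ) (A := ℝ) 4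
  exact (h1.add (isAlgebraic_sqrt_nat 5)).mul h4.inv

/-- Auxiliary step `sin_pi_div_five_pos`: sin pi div five pos. [bookkeeping] -/
theorem sin_pi_div_five_pos : 0 < Real.sin (Real.pi / 5) :=
  Real.sin_pos_of_pos_of_lt_pi (by positivity) (by linarith [Real.pi_pos])

/-- Auxiliary step `sin_two_pi_div_five_pos`: sin two pi div five pos. [bookkeeping] -/
private theorem sin_two_pi_div_five_pos : 0 < Real.sin (2 * Real.pi / 5) :=
  Real.sin_pos_of_pos_of_lt_pi (by positivity) (by linarith [Real.pi_pos])

/-- `sin(π/5)` is algebraic (`sin² = 1 − cos²`). [folklore] -/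
theorem isAlgebraic_sin_pi_div_five : IsAlgebraic ℚ (Real.sin (Real.pi / 5)) := by
  have h : Real.sin (Real.pi / 5) ^ 2 = 1 - Real.cos (Real.pi / 5) ^ 2 := by
    have := Real.sin_sq_add_cos_sq (Real.pi / 5); linarith
  have h2 : IsAlgebraic ℚ (Real.sin (Real.pi / 5) ^ 2) := by
    rw [h]; exact isAlgebraic_one.sub (isAlgebraic_cos_pi_div_five.pow 2)
  exact IsAlgebraic.of_pow (by norm_num) h2

/-- `sin(2π/5) = 2 sin(π/5) cos(π/5)` is algebraic. [folklore] -/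
theorem isAlgebraic_sin_two_pi_div_five : IsAlgebraic ℚ (Real.sin (2 * Real.pi / 5)) := by
  rw [show 2 * Real.pi / 5 = 2 * (Real.pi / 5) by ring, Real.sin_two_mul]
  have h2 : IsAlgebraic ℚ (2:ℝ) := by simpa using isAlgebraic_nat (R := ℚ) (A := ℝ) 2
  exact (h2.mul isAlgebraic_sin_pi_div_five).mul isAlgebraic_cos_pi_div_five

/-- Reflection at `⅕`: `Γ(⅘) = (π / sin(π/5)) · Γ(⅕)⁻¹`. [folklore] -/
theorem Gamma_four_fifths :
    Real.Gamma ((4:ℝ)/5) = Real.pi / Real.sin (Real.pi / 5) * (Real.Gamma ((1:ℝ)/5))⁻¹ := by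
  have h := Real.Gamma_mul_Gamma_one_sub ((1:ℝ)/5)
  rw [show (1:ℝ) - 1/5 = 4/5 by norm_num, show Real.pi * (1/5) = Real.pi / 5 by ring] at h
  have hG : Real.Gamma ((1:ℝ)/5) ≠ 0 := (Real.Gamma_pos_of_pos (by norm_num)).ne'
  rw [eq_mul_inv_iff_mul_eq₀ hG, mul_comm]
  exact h

/-- Reflection at `⅖`: `Γ(⅗) = (π / sin(2π/5)) · Γ(⅖)⁻¹`. [folklore] -/
theorem Gamma_three_fifths :
    Real.Gamma ((3:ℝ)/5) = Real.pi / Real.sin (2 * Real.pi / 5) * (Real.Gamma ((2:ℝ)/5))⁻¹ := by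
  have h := Real.Gamma_mul_Gamma_one_sub ((2:ℝ)/5)
  rw [show (1:ℝ) - 2/5 = 3/5 by norm_num, show Real.pi * (2/5) = 2 * Real.pi / 5 by ring] at h
  have hG : Real.Gamma ((2:ℝ)/5) ≠ 0 := (Real.Gamma_pos_of_pos (by norm_num)).ne'
  rw [eq_mul_inv_iff_mul_eq₀ hG, mul_comm]
  exact h

/-- The fractional parts at level 5: `{w·i/5} = ((w i) % 5)/5`. [bookkeeping] -/
theorem fract_five (w i : ℕ) :
    Int.fract ((w : ℚ) * (i : ℚ) / ((5 : ℕ) : ℚ)) = (((w * i) % 5 : ℕ) : ℚ) / ((5 : ℕ) : ℚ) := by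
  rw [show (w : ℚ) * (i : ℚ) / ((5 : ℕ) : ℚ) = ((w * i : ℕ) : ℚ) / ((5 : ℕ) : ℚ) by push_cast; ring]
  exact Int.fract_div_natCast_eq_div_natCast_mod

/-- **LATTICE FACT at level 5**: a multiplicity vector has DKO type ≡ 0 iff `n₁ = n₄`, `n₂ = n₃`, `n₃ + n₄ = 0`
(i.e. `n ∈ ℤ·(1,−1,−1,1)`, the reflection quotient `Γ(⅕)Γ(⅘)/(Γ(⅖)Γ(⅗)) = 2cos(π/5)`). [this node] -/
theorem hodgeType_five_iff (n : ℕ → ℤ) :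
    IsHodgeTypeGammaMonomial 5 n 0 ↔ (n 1 - n 4 = 0 ∧ n 2 - n 3 = 0 ∧ n 3 + n 4 = 0) := by
  constructor
  · intro hT
    have e1 := hT 1 (by decide)
    have e2 := hT 2 (by decide)
    have e3 := hT 3 (by decide)
    rw [sum_Ico_one_five, fract_five, fract_five, fract_five, fract_five] at e1 e2 e3
    norm_num at e1 e2 e3
    have i1 : n 1 + 2 * n 2 + 3 * n 3 + 4 * n 4 = 0 := by
      have : ((n 1 + 2 * n 2 + 3 * n 3 + 4 * n 4 : ℤ) : ℚ) = 0 := by push_cast; linear_combination 5 * e1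
      exact_mod_cast this
    have i2 : 2 * n 1 + 4 * n 2 + n 3 + 3 * n 4 = 0 := by
      have : ((2 * n 1 + 4 * n 2 + n 3 + 3 * n 4 : ℤ) : ℚ) = 0 := by push_cast; linear_combination 5 * e2
      exact_mod_cast this
    have i3 : 3 * n 1 + n 2 + 4 * n 3 + 2 * n 4 = 0 := by
      have : ((3 * n 1 + n 2 + 4 * n 3 + 2 * n 4 : ℤ) : ℚ) = 0 := by push_cast; linear_combination 5 * e3
      exact_mod_cast this
    omega
  · rintro ⟨q1, q2, q3⟩
    intro w hw
    rw [sum_Ico_one_five, fract_five, fract_five, fract_five, fract_five]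
    have r1 : ((n 1 - n 4 : ℤ) : ℚ) = 0 := by rw [q1]; simp
    have r2 : ((n 2 - n 3 : ℤ) : ℚ) = 0 := by rw [q2]; simp
    have r3 : ((n 3 + n 4 : ℤ) : ℚ) = 0 := by rw [q3]; simp
    push_cast at r1 r2 r3
    have hw' : w % 5 = 1 ∨ w % 5 = 2 ∨ w % 5 = 3 ∨ w % 5 = 4 := by
      have h5 : ¬ 5 ∣ w := fun hd => absurd (Nat.Coprime.coprime_dvd_left hd hw) (by decide)
      omega
    rcases hw' with h | h | h | h
    · have a1 : (w * 1) % 5 = 1 := by omega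
      have a2 : (w * 2) % 5 = 2 := by omega
      have a3 : (w * 3) % 5 = 3 := by omega
      have a4 : (w * 4) % 5 = 4 := by omega
      rw [a1, a2, a3, a4]; push_cast
      linear_combination (r1 + 2 * r2 + 5 * r3) / 5
    · have a1 : (w * 1) % 5 = 2 := by omega
      have a2 : (w * 2) % 5 = 4 := by omega
      have a3 : (w * 3) % 5 = 1 := by omega
      have a4 : (w * 4) % 5 = 3 := by omega
      rw [a1, a2, a3, a4]; push_cast
      linear_combination (2 * r1 + 4 * r2 + 5 * r3) / 5
    · have a1 : (w * 1) % 5 = 3 := by omega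
      have a2 : (w * 2) % 5 = 1 := by omega
      have a3 : (w * 3) % 5 = 4 := by omega
      have a4 : (w * 4) % 5 = 2 := by omega
      rw [a1, a2, a3, a4]; push_cast
      linear_combination (3 * r1 + r2 + 5 * r3) / 5
    · have a1 : (w * 1) % 5 = 4 := by omega
      have a2 : (w * 2) % 5 = 3 := by omega
      have a3 : (w * 3) % 5 = 2 := by omega
      have a4 : (w * 4) % 5 = 1 := by omega
      rw [a1, a2, a3, a4]; push_cast
      linear_combination (4 * r1 + 3 * r2 + 5 * r3) / 5

/-- **NORMAL FORM at level 5**: every Γ-monomial on `Γ(m/5)` is `C · Γ(⅕)^{n₁−n₄} · Γ(⅖)^{n₂−n₃} · π^{n₃+n₄}` with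
`C = sin(2π/5)^{−n₃} sin(π/5)^{−n₄} ∈ ℚ̄ˣ`. [this node] -/
theorem monomial_five_normalForm (n : ℕ → ℤ) :
    ∃ C : ℝ, IsAlgebraic ℚ C ∧ C ≠ 0 ∧
      ∏ m ∈ Finset.Ico (1:ℕ) 5, Real.Gamma ((m : ℝ) / ((5:ℕ):ℝ)) ^ n m
        = C * Real.Gamma ((1:ℝ)/5) ^ (n 1 - n 4) * Real.Gamma ((2:ℝ)/5) ^ (n 2 - n 3) * Real.pi ^ (n 3 + n 4) := by
  have hG1 : Real.Gamma ((1:ℝ)/5) ≠ 0 := (Real.Gamma_pos_of_pos (by norm_num)).ne'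
  have hG2 : Real.Gamma ((2:ℝ)/5) ≠ 0 := (Real.Gamma_pos_of_pos (by norm_num)).ne'
  have hπ : Real.pi ≠ 0 := Real.pi_ne_zero
  have hs1 : Real.sin (Real.pi / 5) ≠ 0 := sin_pi_div_five_pos.ne'
  have hs2 : Real.sin (2 * Real.pi / 5) ≠ 0 := sin_two_pi_div_five_pos.ne'
  -- generator table
  let c : ℕ → ℝ := fun m => if m = 3 then (Real.sin (2 * Real.pi / 5))⁻¹ else if m = 4 then (Real.sin (Real.pi / 5))⁻¹ else 1
  let a : ℕ → ℤ := fun m => if m = 1 then 1 else if m = 4 then -1 else 0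
  let b : ℕ → ℤ := fun m => if m = 2 then 1 else if m = 3 then -1 else 0
  let e : ℕ → ℤ := fun m => if m = 3 then 1 else if m = 4 then 1 else 0
  have hgen : ∀ m : ℕ, m ∈ Finset.Ico 1 5 →
      Real.Gamma ((m : ℝ) / ((5:ℕ):ℝ)) ^ n m
        = (c m * Real.Gamma ((1:ℝ)/5) ^ a m * Real.Gamma ((2:ℝ)/5) ^ b m * Real.pi ^ e m) ^ n m := by
    intro m hm
    congr 1
    have hm' : m = 1 ∨ m = 2 ∨ m = 3 ∨ m = 4 := by
      have := Finset.mem_Ico.mp hm; omega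
    rcases hm' with rfl | rfl | rfl | rfl
    · simp (decide := true) only [c, a, b, e, if_true, if_false, Nat.cast_one, Nat.cast_ofNat,
        zpow_one, zpow_zero, one_mul, mul_one]
    · simp (decide := true) only [c, a, b, e, if_true, if_false, Nat.cast_ofNat,
        zpow_one, zpow_zero, one_mul, mul_one]
    · simp (decide := true) only [c, a, b, e, if_true, if_false, Nat.cast_ofNat,
        zpow_one, zpow_zero, mul_one, zpow_neg]
      rw [Gamma_three_fifths]
      field_simp
    · simp (decide := true) only [c, a, b, e, if_true, if_false, Nat.cast_ofNat,
        zpow_one, zpow_zero, mul_one, zpow_neg]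
      rw [Gamma_four_fifths]
      field_simp
  refine ⟨∏ m ∈ Finset.Ico 1 5, c m ^ n m, ?_, ?_, ?_⟩
  · rw [prod_Ico_one_five]
    simp (decide := true) only [c, if_true, if_false, one_zpow, one_mul]
    exact (isAlgebraic_zpow isAlgebraic_sin_two_pi_div_five.inv _).mul
      (isAlgebraic_zpow isAlgebraic_sin_pi_div_five.inv _)
  · refine Finset.prod_ne_zero_iff.mpr fun m hm => zpow_ne_zero _ ?_
    simp only [c]
    split_ifs
    · exact inv_ne_zero hs2
    · exact inv_ne_zero hs1
    · exact one_ne_zero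
  · rw [Finset.prod_congr rfl hgen, prod_mul_zpow3 _ c a b e n hG1 hG2 hπ,
      sum_Ico_one_five_int, sum_Ico_one_five_int, sum_Ico_one_five_int]
    simp (decide := true) only [a, b, e, if_true, if_false]
    ring_nf

/-- **LEVEL FIVE, TYPED EXACTLY: `RohrlichHodgeAt 5 ⟺` multiplicative independence of `Γ(⅕), Γ(⅖), π` mod `ℚ̄ˣ`.**
(⟸: normal form + the lattice fact; ⟹: test the monomial `Γ(⅕)^a Γ(⅖)^{b+c} Γ(⅗)^c = sin(2π/5)^{−c}·Γ(⅕)^aΓ(⅖)^bπ^c`.) [this node] -/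
theorem rohrlichHodgeAtFive_iff : RohrlichHodgeAtFive ↔ GammaFifthPiIndep := by
  have hG1 : Real.Gamma ((1:ℝ)/5) ≠ 0 := (Real.Gamma_pos_of_pos (by norm_num)).ne'
  have hG2 : Real.Gamma ((2:ℝ)/5) ≠ 0 := (Real.Gamma_pos_of_pos (by norm_num)).ne'
  have hπ : Real.pi ≠ 0 := Real.pi_ne_zero
  constructor
  · intro hR a b c habc halg
    -- the test vector
    let n : ℕ → ℤ := fun m => if m = 1 then a else if m = 2 then b + c else if m = 3 then c else 0
    obtain ⟨C, hCalg, hC0, hnf⟩ := monomial_five_normalForm n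
    have hn1 : n 1 - n 4 = a := by simp (decide := true) only [n, if_true, if_false]; ring
    have hn2 : n 2 - n 3 = b := by simp (decide := true) only [n, if_true, if_false]; ring
    have hn3 : n 3 + n 4 = c := by simp (decide := true) only [n, if_true, if_false]; ring
    rw [hn1, hn2, hn3] at hnf
    have hmon : IsAlgebraic ℚ (∏ m ∈ Finset.Ico (1:ℕ) 5, Real.Gamma ((m : ℝ) / ((5:ℕ):ℝ)) ^ n m) := by
      rw [hnf, mul_assoc, mul_assoc]
      refine hCalg.mul ?_
      rw [← mul_assoc]; exact halg
    have hT := (hodgeType_five_iff n).mp (hR n hmon)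
    rw [hn1, hn2, hn3] at hT
    rcases habc with h | h | h
    · exact h hT.1
    · exact h hT.2.1
    · exact h hT.2.2
  · intro hI n halg
    obtain ⟨C, hCalg, hC0, hnf⟩ := monomial_five_normalForm n
    rw [hnf] at halg
    have hX : IsAlgebraic ℚ (Real.Gamma ((1:ℝ)/5) ^ (n 1 - n 4) * Real.Gamma ((2:ℝ)/5) ^ (n 2 - n 3)
        * Real.pi ^ (n 3 + n 4)) := by
      have h2 := hCalg.inv.mul halg
      rwa [← mul_assoc, ← mul_assoc, ← mul_assoc, inv_mul_cancel₀ hC0, one_mul] at h2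
    refine (hodgeType_five_iff n).mpr ?_
    by_contra hne
    have hne' : n 1 - n 4 ≠ 0 ∨ n 2 - n 3 ≠ 0 ∨ n 3 + n 4 ≠ 0 := by omega
    exact hI _ _ _ hne' hX

/-- One direction isolated for the node's bridge: the OPEN hypothesis gives the level-5 shadow. [this node] -/
theorem rohrlichHodgeAtFive_of (h : GammaFifthPiIndep) : RohrlichHodgeAtFive := rohrlichHodgeAtFive_iff.mpr h

/-- Sanity (Lindemann is the `(0,0,c)` case): `π^c ∉ ℚ̄` for `c ≠ 0` — so `GammaFifthPiIndep` is consistent with, and extends, what the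
tree proves. [tree: `transcendental_pi_holds`] -/
theorem gammaFifthPiIndep_case_pi {c : ℤ} (hc : c ≠ 0) :
    Transcendental ℚ (Real.Gamma ((1:ℝ)/5) ^ (0:ℤ) * Real.Gamma ((2:ℝ)/5) ^ (0:ℤ) * Real.pi ^ c) := by
  rw [zpow_zero, zpow_zero, one_mul, one_mul]
  intro h
  rcases Int.natAbs_eq c with e | e
  · rw [e, zpow_natCast] at h
    exact transcendental_pi_holds (IsAlgebraic.of_pow (Int.natAbs_pos.mpr hc) h)
  · rw [e, zpow_neg, zpow_natCast] at h
    exact transcendental_pi_holds (IsAlgebraic.of_pow (Int.natAbs_pos.mpr hc) (by simpa using h.inv))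

end Summit.KontsevichZagierPeriods.FermatIsogeny.DeepTargets.LevelFive
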